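import Summits.QuantumFields.YangMills.Theorems.BalabanUVNodesClustersCore
import Summits.QuantumFields.YangMills.Theorems.BalabanUVNodesN21ShellWeightKnit
import Summits.QuantumFields.BalabanUV.T4Continuum.Support.ShellMeasureRootComposition
import Summits.QuantumFields.BalabanUV.T4Continuum.Support.ShellMeasureRootCompositionSeam

/-!
# YM-DAG node N21 (= NE7c) AT THE SPINE CARRIERS, MEASURE LEVEL: the K5 stub `YMDAG.UVSplit.S_N21 SRec` for every carrier predicate that
# hands END-I's slot data — per live slot a finite measure and a tested variable, the [dict] push, and THE WALL (M1)
# `T4ShellMeasure.SlotAntiConcentration` DISPLAYED PER SLOT BY LEVEL — plus the live window (N20), `D ≤ D̄` (N12) and the width rate (N16)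
# (`ShellMeasureRootComposition.levelLedger_of_slotAC` + file 1's `n21_knit_levels` BY NAME)

Track A of `YM-PLAN.md` (cell `pub-ymgap`, HUMAN RULING D-0062), node **N21**; seat `pub-ymgap-dag-n21-a`, generation 4, file 8″ (companion of file 8
`BalabanUVNodesN21AtSpineCarriers` p417321: there the road-I reading is stated with the two `LevelLedger`s as data; HERE the ledgers are PRODUCED from
measure-level slot data, so that the one non-printed estimate of road I — (M1) at levels `≥ 1` — appears VERBATIM in the cluster currency).  Kernel
bookkeeping BY NAME: 0 `def`, 0 `sorry`, standard axioms.  COUNT-NEUTRAL; `--supports` the K5 item.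

HONEST FRAMING.  NE7c is NOT PRINTED and NOT PROVED.  This is END-I (`ShellMeasureRootComposition.shellWeightBound_of_slotAC`, p207618, the
`pub-balaban` t4-ne7c lineage) read at the K5 stub: `S_N21 SRec` holds for every record predicate `SRec` that hands, with each carrier bundle `S` it
pins, per run X ∈ {A, B}: slot types `σX`, per slot `s ∈ SX K` at source `t` a FINITE measure `μX K t s` on a measurable space `ΩX K s` (the run's
measure with the slot's own indicator removed — the TERM OBJECT, NODE O) and the slot's tested variable `uX K t s`; levels `lvlX`, thresholds `θX_j`,
widths `ρX_j ≥ 0`, constants `DX_j ≥ 0`, [dict] constants `MX K t s ≥ 0` with the PUSH `piece_le`∕`total_ge` ([dict], NODE O); (R) `0 ≤ shX ≤ X`, `cover`;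
THE WALL `hac` = `SlotAntiConcentration (μX K t s) (uX K t s) (θX (lvlX K s)) (ρX (lvlX K s)) (DX (lvlX K s))` for every live slot (N21-OWN, NOT PRINTED
at levels `≥ 1`; level `0` for `SU(2)`: `ShellMeasureWilsonRealizedSU2.slotAntiConcentration_wilson_su2`); and jointly: live windows
`LiveWindow SX lvlX N₁ ν̄` (N20), `DX_j ≤ D̄` (N12, [B15] p. 193 template), `0 < ϑ < 1`, `ρX_j ≤ c₁ϑ^j` (N16, files 3∕6), `S.Wsh ≥ 2((N₁+1)ν̄D̄c₁ϑ^{−N₁})ϑ^K`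
summable.  Nothing of Bałaban's is asserted; one finite four-torus at fixed `ε`; NOT continuum ∕ ℝ⁴ ∕ OS ∕ mass gap ∕ Clay.

WHAT IS PROVED ([folklore]).  `s_N21_of_slotACReading` (v1.0, p419030).  v1.1 (APPEND-ONLY; + import of the seam `ShellMeasureRootCompositionSeam`):
§2 `s_N21_of_realizedReading` — ROAD (δ) at the K5 stub: the INPUTS of `T4ShellMeasure.SlotLedger.of_realized` (the two TILT inequalities) and the
realized shell fractions under one geometric majorant (the chosen assignment's budget) displayed, NO (M1); §3 `s_N21_of_levelDataSU2Reading` (`N = 2`)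
— the SEAM END-I ∘ END-II at the K5 stub: slot measures `(fieldMeasure P (lvl K s) SU2).withDensity (F K t s)` on Bałaban's level-`j` gauge fields,
(M1) per slot with SLOT constants and slot→level majorants displayed.
-/

set_option autoImplicit false

noncomputable section

open scoped BigOperators
open MeasureTheory

namespace Summit.QuantumFields.YangMills.Theorems.N21AtSpineCarriers

open Literature.MathematicalPhysics.QuantumFieldTheory.Balaban1983to89
open T4IndicatorShell (ShellWeightBound)
open T4ShellMeasure (SlotAntiConcentration SlotLedger shellWeightBound_of_realized)
open T4ShellMeasureLevels (LevelLedger LiveWindow)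
open Summit.QuantumFields.BalabanUV.T4Continuum.ShellMeasureRootComposition (levelLedger_of_slotAC)
open Summit.QuantumFields.BalabanUV.T4Continuum.ShellMeasureRootCompositionSeam (levelLedger_of_levelDataSU2)
open YMDAG.UVSplit (SpineCarriers SpineRecordPred S_N21)
open Finset

/-- **`S_N21` FOR EVERY MEASURE-LEVEL (END-I) READING.**  If the carrier predicate `SRec` hands, with every carrier bundle `S` it pins, END-I's slot
data and binders for both runs — per live slot a finite measure and a tested variable, (R), the [dict] push, THE WALL (M1) `SlotAntiConcentration` per
slot by level —, the two live windows, `D ≤ D̄`, the width rate `ρ_j ≤ c₁ϑ^j` (`0 < ϑ < 1`) and a summable record weight `S.Wsh` dominating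
`2((N₁+1)ν̄D̄c₁ϑ^{−N₁})ϑ^K`, then `S_N21 SRec` — `ShellMeasureRootComposition.levelLedger_of_slotAC` (×2) + file 1's `n21_knit_levels` BY NAME.
CONDITIONAL on every displayed binder; NE7c NOT proved. [folklore] -/
theorem s_N21_of_slotACReading {N : ℕ} [NeZero N] (SRec : SpineRecordPred N)
    (hread : ∀ (F : T4Continuum.T4Family) (D : YMDAG.UVSplit.Datum F N) (g₀ : ℕ → ℝ)
      (os : List (T4Continuum.ULoop F)) (S : SpineCarriers), SRec F D g₀ os S →
      ∃ (σA σB : Type) (ΩA : ℕ → σA → Type) (ΩB : ℕ → σB → Type)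
        (_mA : ∀ K s, MeasurableSpace (ΩA K s)) (_mB : ∀ K s, MeasurableSpace (ΩB K s))
        (μA : ∀ K : ℕ, ℝ → ∀ s : σA, Measure (ΩA K s)) (μB : ∀ K : ℕ, ℝ → ∀ s : σB, Measure (ΩB K s))
        (_fA : ∀ K t s, IsFiniteMeasure (μA K t s)) (_fB : ∀ K t s, IsFiniteMeasure (μB K t s))
        (uA : ∀ K : ℕ, ℝ → ∀ s : σA, ΩA K s → ℝ) (uB : ∀ K : ℕ, ℝ → ∀ s : σB, ΩB K s → ℝ)
        (SA : ℕ → Finset σA) (SB : ℕ → Finset σB)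
        (pieceA : ℕ → ℝ → σA → S.ι → ℝ) (pieceB : ℕ → ℝ → σB → S.ι → ℝ)
        (lvlA : ℕ → σA → ℕ) (lvlB : ℕ → σB → ℕ) (θA DA ρA θB DB ρB : ℕ → ℝ)
        (MA : ℕ → ℝ → σA → ℝ) (MB : ℕ → ℝ → σB → ℝ) (N₁ : ℕ) (νbar Dbar c₁ ϑ : ℝ),
        -- run A: (R), [dict] push, THE WALL (M1) per slot by level
        (∀ K t, |t| ≤ S.l₀ → ∀ τ ∈ S.T K, 0 ≤ S.shA K t τ) ∧
        (∀ K t, |t| ≤ S.l₀ → ∀ τ ∈ S.T K, S.shA K t τ ≤ S.A K t τ) ∧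
        (∀ K t, |t| ≤ S.l₀ → ∀ τ ∈ S.T K, S.shA K t τ ≤ ∑ s ∈ SA K, pieceA K t s τ) ∧
        (∀ K t, |t| ≤ S.l₀ → ∀ s ∈ SA K, 0 ≤ MA K t s) ∧
        (∀ K t, |t| ≤ S.l₀ → ∀ s ∈ SA K, ∑ τ ∈ S.T K, pieceA K t s τ ≤ MA K t s *
          (μA K t s {x | θA (lvlA K s) * (1 - ρA (lvlA K s)) ≤ uA K t s x ∧ uA K t s x < θA (lvlA K s)}).toReal) ∧
        (∀ K t, |t| ≤ S.l₀ → ∀ s ∈ SA K, MA K t s * (μA K t s Set.univ).toReal ≤ ∑ τ ∈ S.T K, S.A K t τ) ∧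
        (∀ j, 0 ≤ DA j) ∧ (∀ j, 0 ≤ ρA j) ∧
        (∀ K t, |t| ≤ S.l₀ → ∀ s ∈ SA K,
          SlotAntiConcentration (μA K t s) (uA K t s) (θA (lvlA K s)) (ρA (lvlA K s)) (DA (lvlA K s))) ∧
        -- run B: (R), [dict] push, THE WALL (M1) per slot by level
        (∀ K t, |t| ≤ S.l₀ → ∀ τ ∈ S.T K, 0 ≤ S.shB K t τ) ∧
        (∀ K t, |t| ≤ S.l₀ → ∀ τ ∈ S.T K, S.shB K t τ ≤ S.B K t τ) ∧
        (∀ K t, |t| ≤ S.l₀ → ∀ τ ∈ S.T K, S.shB K t τ ≤ ∑ s ∈ SB K, pieceB K t s τ) ∧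
        (∀ K t, |t| ≤ S.l₀ → ∀ s ∈ SB K, 0 ≤ MB K t s) ∧
        (∀ K t, |t| ≤ S.l₀ → ∀ s ∈ SB K, ∑ τ ∈ S.T K, pieceB K t s τ ≤ MB K t s *
          (μB K t s {x | θB (lvlB K s) * (1 - ρB (lvlB K s)) ≤ uB K t s x ∧ uB K t s x < θB (lvlB K s)}).toReal) ∧
        (∀ K t, |t| ≤ S.l₀ → ∀ s ∈ SB K, MB K t s * (μB K t s Set.univ).toReal ≤ ∑ τ ∈ S.T K, S.B K t τ) ∧
        (∀ j, 0 ≤ DB j) ∧ (∀ j, 0 ≤ ρB j) ∧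
        (∀ K t, |t| ≤ S.l₀ → ∀ s ∈ SB K,
          SlotAntiConcentration (μB K t s) (uB K t s) (θB (lvlB K s)) (ρB (lvlB K s)) (DB (lvlB K s))) ∧
        -- (W1) windows + count (N20), constant bound (N12), rate (N16), the record weight slot
        LiveWindow SA lvlA N₁ νbar ∧ LiveWindow SB lvlB N₁ νbar ∧ 0 < ϑ ∧ ϑ < 1 ∧
        (∀ j, DA j ≤ Dbar) ∧ (∀ j, DB j ≤ Dbar) ∧ (∀ j, ρA j ≤ c₁ * ϑ ^ j) ∧ (∀ j, ρB j ≤ c₁ * ϑ ^ j) ∧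
        (∀ K, (2 * ((N₁ + 1) * νbar * Dbar * c₁ * ϑ⁻¹ ^ N₁)) * ϑ ^ K ≤ S.Wsh K) ∧ Summable S.Wsh) :
    S_N21 SRec := by
  intro F D g₀ os S hS
  obtain ⟨σA, σB, ΩA, ΩB, mA, mB, μA, μB, fA, fB, uA, uB, SA, SB, pieceA, pieceB, lvlA, lvlB, θA, DA, ρA, θB, DB, ρB,
    MA, MB, N₁, νbar, Dbar, c₁, ϑ, sh_nonnegA, sh_leA, coverA, hMA, piece_leA, total_geA, hDA0, hρA0, hacA,
    sh_nonnegB, sh_leB, coverB, hMB, piece_leB, total_geB, hDB0, hρB0, hacB,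
    hwA, hwB, hϑ0, hϑ1, hDA, hDB, hrA, hrB, hWsh, hsum⟩ := hread F D g₀ os S hS
  exact n21_knit_levels
    (levelLedger_of_slotAC sh_nonnegA sh_leA coverA hMA piece_leA total_geA hDA0 hρA0 hacA)
    (levelLedger_of_slotAC sh_nonnegB sh_leB coverB hMB piece_leB total_geB hDB0 hρB0 hacB)
    hwA hwB hDA hDB hϑ0 hϑ1 hrA hrB hWsh hsum

/-! ## §2 (v1.1) ROAD (δ) at the K5 stub: two REALIZED slot ledgers — the tilts and the chosen-threshold budget displayed, NO (M1) -/

/-- **`S_N21` FOR EVERY REALIZED (road (δ)) READING.**  If `SRec` hands, with every bundle `S` it pins, per run X ∈ {A, B} the INPUTS of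
`T4ShellMeasure.SlotLedger.of_realized` at the carriers — (R) `0 ≤ shX ≤ X`, `cover` by per-slot pieces, pieces nonnegative at the source origin `t = 0`,
positive run totals at `t = 0`, and the two TILT inequalities (`|t·source| ≤ a`: pieces at `t` `≤ e^a ×` pieces at `0`; total at `0` `≤ e^a ×` total at `t`)
— together with the REALIZED shell fractions at `t = 0` under one geometric majorant `C·ϑ^K`, `0 ≤ ϑ < 1` (this is the OUTPUT of the threshold choice
`Spine/NE7c/LiveFactorGlobalCompact.exists_global_assignment_compact`: the term object of record WRITTEN WITH the chosen assignment), and a summable record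
weight `S.Wsh ≥ 2e^{2a}C·ϑ^K`, then `S_N21 SRec` — `SlotLedger.of_realized` ×2 + `shellWeightBound_of_realized` + file 1's `shellWeightBound_mono` BY NAME.
No anti-concentration hypothesis appears: on road (δ) it has been CONSUMED by the choice.  CONDITIONAL on every displayed binder; NE7c NOT proved. [folklore] -/
theorem s_N21_of_realizedReading {N : ℕ} [NeZero N] (SRec : SpineRecordPred N)
    (hread : ∀ (F : T4Continuum.T4Family) (D : YMDAG.UVSplit.Datum F N) (g₀ : ℕ → ℝ)
      (os : List (T4Continuum.ULoop F)) (S : SpineCarriers), SRec F D g₀ os S →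
      ∃ (σA σB : Type) (SA : ℕ → Finset σA) (SB : ℕ → Finset σB) (pieceA : ℕ → ℝ → σA → S.ι → ℝ)
        (pieceB : ℕ → ℝ → σB → S.ι → ℝ) (a C ϑ : ℝ),
        -- run A: (R) + pieces nonnegative at the origin + positive totals + the two tilts
        (∀ K t, |t| ≤ S.l₀ → ∀ τ ∈ S.T K, 0 ≤ S.shA K t τ) ∧
        (∀ K t, |t| ≤ S.l₀ → ∀ τ ∈ S.T K, S.shA K t τ ≤ S.A K t τ) ∧
        (∀ K t, |t| ≤ S.l₀ → ∀ τ ∈ S.T K, S.shA K t τ ≤ ∑ s ∈ SA K, pieceA K t s τ) ∧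
        (∀ K, ∀ s ∈ SA K, ∀ τ ∈ S.T K, 0 ≤ pieceA K 0 s τ) ∧
        (∀ K, 0 < ∑ τ ∈ S.T K, S.A K 0 τ) ∧
        (∀ K t, |t| ≤ S.l₀ → ∀ s ∈ SA K, ∑ τ ∈ S.T K, pieceA K t s τ ≤ Real.exp a * ∑ τ ∈ S.T K, pieceA K 0 s τ) ∧
        (∀ K t, |t| ≤ S.l₀ → ∑ τ ∈ S.T K, S.A K 0 τ ≤ Real.exp a * ∑ τ ∈ S.T K, S.A K t τ) ∧
        -- run B: the same
        (∀ K t, |t| ≤ S.l₀ → ∀ τ ∈ S.T K, 0 ≤ S.shB K t τ) ∧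
        (∀ K t, |t| ≤ S.l₀ → ∀ τ ∈ S.T K, S.shB K t τ ≤ S.B K t τ) ∧
        (∀ K t, |t| ≤ S.l₀ → ∀ τ ∈ S.T K, S.shB K t τ ≤ ∑ s ∈ SB K, pieceB K t s τ) ∧
        (∀ K, ∀ s ∈ SB K, ∀ τ ∈ S.T K, 0 ≤ pieceB K 0 s τ) ∧
        (∀ K, 0 < ∑ τ ∈ S.T K, S.B K 0 τ) ∧
        (∀ K t, |t| ≤ S.l₀ → ∀ s ∈ SB K, ∑ τ ∈ S.T K, pieceB K t s τ ≤ Real.exp a * ∑ τ ∈ S.T K, pieceB K 0 s τ) ∧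
        (∀ K t, |t| ≤ S.l₀ → ∑ τ ∈ S.T K, S.B K 0 τ ≤ Real.exp a * ∑ τ ∈ S.T K, S.B K t τ) ∧
        -- the realized shell fractions at the origin under ONE geometric majorant (the chosen assignment's budget)
        0 ≤ ϑ ∧ ϑ < 1 ∧
        (∀ K, ∑ s ∈ SA K, ∑ τ ∈ S.T K, pieceA K 0 s τ ≤ (C * ϑ ^ K) * ∑ τ ∈ S.T K, S.A K 0 τ) ∧
        (∀ K, ∑ s ∈ SB K, ∑ τ ∈ S.T K, pieceB K 0 s τ ≤ (C * ϑ ^ K) * ∑ τ ∈ S.T K, S.B K 0 τ) ∧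
        -- the record weight slot
        (∀ K, 2 * (Real.exp (2 * a) * (C * ϑ ^ K)) ≤ S.Wsh K) ∧ Summable S.Wsh) :
    S_N21 SRec := by
  intro F D g₀ os S hS
  obtain ⟨σA, σB, SA, SB, pieceA, pieceB, a, C, ϑ, sh_nonnegA, sh_leA, coverA, piece_nonnegA, hZA, tiltSA, tiltZA,
    sh_nonnegB, sh_leB, coverB, piece_nonnegB, hZB, tiltSB, tiltZB, hϑ0, hϑ1, hqA, hqB, hWsh, hsum⟩ := hread F D g₀ os S hS
  have hA := SlotLedger.of_realized sh_nonnegA sh_leA coverA piece_nonnegA hZA tiltSA tiltZA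
  have hB := SlotLedger.of_realized sh_nonnegB sh_leB coverB piece_nonnegB hZB tiltSB tiltZB
  refine shellWeightBound_mono (shellWeightBound_of_realized hA hB hZA hZB hϑ0 hϑ1 hqA hqB) (fun K => ?_) hsum
  have h1 := hA.omega_of_realized_le K (hZA K) (hqA K)
  have h2 := hB.omega_of_realized_le K (hZB K) (hqB K)
  exact (add_le_add h1 h2).trans ((two_mul _).symm.le.trans (hWsh K))

/-! ## §3 (v1.1) END-I ∘ END-II (the SEAM) at the K5 stub, `N = 2`: realized `SU(2)` slot families on Bałaban's level-`j` field measures -/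

/-- **`S_N21` (at `N = 2`) FOR EVERY REALIZED-`SU(2)` LEVEL-DATA READING.**  As `s_N21_of_slotACReading`, with the slot measures SPECIALISED to the
cell's realized form `(fieldMeasure P (lvlX K s) SU2).withDensity (FX K t s)` — Bałaban's product Haar measure on the level-`lvlX K s` gauge fields of the
lattice parameters `P`, tilted by the slot's density `FX K t s` (the term's density with the slot's own indicator removed: the TERM OBJECT, NODE O) —,
finiteness `∫⁻ FX K t s ≠ ∞` per slot, (M1) per slot with SLOT constants `DslotX K t s` and the displayed slot→level majorants `DslotX K t s ≤ DX (lvlX K s)`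
(the seam's facts (i)(ii)); windows (N20), `D ≤ D̄` (N12), rate (N16), record weight as before ⟹ `S_N21 SRec` —
`ShellMeasureRootCompositionSeam.levelLedger_of_levelDataSU2` ×2 + file 1's `n21_knit_levels` BY NAME.  This is the K5 statement a realized `SU(2)`
instance of the term object feeds; (M1) stays displayed.  CONDITIONAL on every binder; NE7c NOT proved. [folklore] -/
theorem s_N21_of_levelDataSU2Reading (SRec : SpineRecordPred 2)
    (hread : ∀ (F : T4Continuum.T4Family) (D : YMDAG.UVSplit.Datum F 2) (g₀ : ℕ → ℝ)
      (os : List (T4Continuum.ULoop F)) (S : SpineCarriers), SRec F D g₀ os S →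
      ∃ (P : Params) (σA σB : Type) (SA : ℕ → Finset σA) (SB : ℕ → Finset σB)
        (pieceA : ℕ → ℝ → σA → S.ι → ℝ) (pieceB : ℕ → ℝ → σB → S.ι → ℝ) (lvlA : ℕ → σA → ℕ) (lvlB : ℕ → σB → ℕ)
        (FA : ∀ K : ℕ, ℝ → ∀ s : σA, GaugeField P (lvlA K s) T4CubeChartGnomonic.SU2 → ENNReal)
        (FB : ∀ K : ℕ, ℝ → ∀ s : σB, GaugeField P (lvlB K s) T4CubeChartGnomonic.SU2 → ENNReal)
        (uA : ∀ K : ℕ, ℝ → ∀ s : σA, GaugeField P (lvlA K s) T4CubeChartGnomonic.SU2 → ℝ)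
        (uB : ∀ K : ℕ, ℝ → ∀ s : σB, GaugeField P (lvlB K s) T4CubeChartGnomonic.SU2 → ℝ)
        (θA DA ρA θB DB ρB : ℕ → ℝ) (DslotA MA : ℕ → ℝ → σA → ℝ) (DslotB MB : ℕ → ℝ → σB → ℝ)
        (N₁ : ℕ) (νbar Dbar c₁ ϑ : ℝ),
        -- run A: seam fact (i), (R), [dict] push on the realized slot measure, signs, seam fact (ii), (M1) per slot with SLOT constants
        (∀ K t s, ∫⁻ U, FA K t s U ∂(fieldMeasure P (lvlA K s) T4CubeChartGnomonic.SU2) ≠ ⊤) ∧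
        (∀ K t, |t| ≤ S.l₀ → ∀ τ ∈ S.T K, 0 ≤ S.shA K t τ) ∧
        (∀ K t, |t| ≤ S.l₀ → ∀ τ ∈ S.T K, S.shA K t τ ≤ S.A K t τ) ∧
        (∀ K t, |t| ≤ S.l₀ → ∀ τ ∈ S.T K, S.shA K t τ ≤ ∑ s ∈ SA K, pieceA K t s τ) ∧
        (∀ K t, |t| ≤ S.l₀ → ∀ s ∈ SA K, 0 ≤ MA K t s) ∧
        (∀ K t, |t| ≤ S.l₀ → ∀ s ∈ SA K, ∑ τ ∈ S.T K, pieceA K t s τ ≤ MA K t s *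
          (((fieldMeasure P (lvlA K s) T4CubeChartGnomonic.SU2).withDensity (FA K t s))
            {x | θA (lvlA K s) * (1 - ρA (lvlA K s)) ≤ uA K t s x ∧ uA K t s x < θA (lvlA K s)}).toReal) ∧
        (∀ K t, |t| ≤ S.l₀ → ∀ s ∈ SA K,
          MA K t s * (((fieldMeasure P (lvlA K s) T4CubeChartGnomonic.SU2).withDensity (FA K t s)) Set.univ).toReal ≤
            ∑ τ ∈ S.T K, S.A K t τ) ∧
        (∀ j, 0 ≤ DA j) ∧ (∀ j, 0 ≤ ρA j) ∧
        (∀ K t, |t| ≤ S.l₀ → ∀ s ∈ SA K, DslotA K t s ≤ DA (lvlA K s)) ∧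
        (∀ K t, |t| ≤ S.l₀ → ∀ s ∈ SA K,
          SlotAntiConcentration (((fieldMeasure P (lvlA K s) T4CubeChartGnomonic.SU2).withDensity (FA K t s))) (uA K t s)
            (θA (lvlA K s)) (ρA (lvlA K s)) (DslotA K t s)) ∧
        -- run B: the same
        (∀ K t s, ∫⁻ U, FB K t s U ∂(fieldMeasure P (lvlB K s) T4CubeChartGnomonic.SU2) ≠ ⊤) ∧
        (∀ K t, |t| ≤ S.l₀ → ∀ τ ∈ S.T K, 0 ≤ S.shB K t τ) ∧
        (∀ K t, |t| ≤ S.l₀ → ∀ τ ∈ S.T K, S.shB K t τ ≤ S.B K t τ) ∧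
        (∀ K t, |t| ≤ S.l₀ → ∀ τ ∈ S.T K, S.shB K t τ ≤ ∑ s ∈ SB K, pieceB K t s τ) ∧
        (∀ K t, |t| ≤ S.l₀ → ∀ s ∈ SB K, 0 ≤ MB K t s) ∧
        (∀ K t, |t| ≤ S.l₀ → ∀ s ∈ SB K, ∑ τ ∈ S.T K, pieceB K t s τ ≤ MB K t s *
          (((fieldMeasure P (lvlB K s) T4CubeChartGnomonic.SU2).withDensity (FB K t s))
            {x | θB (lvlB K s) * (1 - ρB (lvlB K s)) ≤ uB K t s x ∧ uB K t s x < θB (lvlB K s)}).toReal) ∧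
        (∀ K t, |t| ≤ S.l₀ → ∀ s ∈ SB K,
          MB K t s * (((fieldMeasure P (lvlB K s) T4CubeChartGnomonic.SU2).withDensity (FB K t s)) Set.univ).toReal ≤
            ∑ τ ∈ S.T K, S.B K t τ) ∧
        (∀ j, 0 ≤ DB j) ∧ (∀ j, 0 ≤ ρB j) ∧
        (∀ K t, |t| ≤ S.l₀ → ∀ s ∈ SB K, DslotB K t s ≤ DB (lvlB K s)) ∧
        (∀ K t, |t| ≤ S.l₀ → ∀ s ∈ SB K,
          SlotAntiConcentration (((fieldMeasure P (lvlB K s) T4CubeChartGnomonic.SU2).withDensity (FB K t s))) (uB K t s)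
            (θB (lvlB K s)) (ρB (lvlB K s)) (DslotB K t s)) ∧
        -- (W1) windows + count (N20), constant bound (N12), rate (N16), the record weight slot
        LiveWindow SA lvlA N₁ νbar ∧ LiveWindow SB lvlB N₁ νbar ∧ 0 < ϑ ∧ ϑ < 1 ∧
        (∀ j, DA j ≤ Dbar) ∧ (∀ j, DB j ≤ Dbar) ∧ (∀ j, ρA j ≤ c₁ * ϑ ^ j) ∧ (∀ j, ρB j ≤ c₁ * ϑ ^ j) ∧
        (∀ K, (2 * ((N₁ + 1) * νbar * Dbar * c₁ * ϑ⁻¹ ^ N₁)) * ϑ ^ K ≤ S.Wsh K) ∧ Summable S.Wsh) :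
    S_N21 SRec := by
  intro F D g₀ os S hS
  obtain ⟨P, σA, σB, SA, SB, pieceA, pieceB, lvlA, lvlB, FA, FB, uA, uB, θA, DA, ρA, θB, DB, ρB, DslotA, MA, DslotB, MB,
    N₁, νbar, Dbar, c₁, ϑ, hFfinA, sh_nonnegA, sh_leA, coverA, hMA, piece_leA, total_geA, hDA0, hρA0, hDslotA, hacA,
    hFfinB, sh_nonnegB, sh_leB, coverB, hMB, piece_leB, total_geB, hDB0, hρB0, hDslotB, hacB,
    hwA, hwB, hϑ0, hϑ1, hDA, hDB, hrA, hrB, hWsh, hsum⟩ := hread F D g₀ os S hS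
  exact n21_knit_levels
    (levelLedger_of_levelDataSU2 hFfinA sh_nonnegA sh_leA coverA hMA piece_leA total_geA hDA0 hρA0 hDslotA hacA)
    (levelLedger_of_levelDataSU2 hFfinB sh_nonnegB sh_leB coverB hMB piece_leB total_geB hDB0 hρB0 hDslotB hacB)
    hwA hwB hDA hDB hϑ0 hϑ1 hrA hrB hWsh hsum

end Summit.QuantumFields.YangMills.Theorems.N21AtSpineCarriers

end
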